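import Summits.PneNP.GCT.Max.KYSharperAllM
import Summits.PneNP.GCT.Max.KYKOneExact
import HarnessLib
import HarnessLib.Audit

/-!
# KYSharperEveryM — the `n ≥ ⌈3m/2⌉+1` Koszul–Young ceiling for EVERY `m` (W1′a without the side condition `m ≥ 5`)

Cell `pub-gct-max` (HOME `run/shared/lean/pub/pub-gct-max/`), track F, THEORY-2 gen 27.  HONEST FRAMING: a CEILING theorem
for ONE family of equations (plain Koszul–Young flattenings `Λ^p ⊗ S^k` of the padded permanent `X₀₀^{n-m}·per_m` against
`det_n`), i.e. a located NEGATIVE for that technique class; it is not a statement about orbit closures, `per` versus `det`,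
VP versus VNP or P versus NP, and it moves no census row.  Occurrence obstructions are ruled out in print (BIP'16);
multiplicity obstructions are the open door.

**What is proved (`KYCannotSeparatePaddedPerSharperEveryM`, `kyCannotSeparatePaddedPerSharperEveryM_holds`).** For every `m`,
every `n` with `2n ≥ 3m+2` (i.e. `n ≥ ⌈3m/2⌉+1`) and every `(p, k)`: `rank KY_{p,k}(X₀₀^{n-m}·per_m) ≤ rank KY_{p,k}(det_n)` in
`S^n(ℂ^{n²})`.  `Max/KYSharperAllM` (`KYCannotSeparatePaddedPerSharper`, W1′a) proves this for `m ≥ 5` symbolically; the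
all-`m` ceiling `Max/KYCannotSeparatePaddedPerAllM` / `Max/KYAllMArithmetic` needs `n ≥ 2m+2`.  The gap is the nine pairs
`(m,n) ∈ {(0,1), (1,3), (2,4), (2,5), (3,6), (3,7), (4,7), (4,8), (4,9)}`, where the exact leading-term count `LT(n,c,k)`
still dominates the permanent-side bound `min(S(m,k)·C(n²,c+1), S(m,k+1)·C(n²,c))` at EVERY primal cell (exact numerics,
THEORY-2 gen 27 `calc34-k1ident/band.py`; it fails at `(4,6)` — two cells — and below), so these sizes are settled by
kernel-decided finite cell tables (`Max/KYKOneExact.kCell`, brute-force mirror, `n ≤ 9`):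

* `KYCells.kyRank_le_of_cells` — the GENERIC assembly: if the primal cell inequality holds at every primal cell
  (`2k+1 ≤ n`, `c+1 ≤ n²`) then `rank KY_{p,k}(X₀₀^{n-m}per_m) ≤ rank KY_{p,k}(det_n)` at every `(p,k)` (primal / dual cell,
  `PaddedPerKYUpperBounds`, `DetKYLeadingTermBound`; the proof of `KYSharper.kyRank_paddedPerPoly_le_detPoly` with the cell
  inequality as a hypothesis) — reusable by the `n = ⌈3m/2⌉` programme;
* `KYCells.cells_of_stageTwo` — the cells for `n ≥ 2m+2` from `KYAllM.stage2_cell`;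
* `KYCells.cells_0_1, …, cells_4_9` — the nine finite tables (`decide +kernel`, 1 186 cells in all);
* the node and `kyCannotSeparatePaddedPerSharperEveryM_of : KYCannotSeparatePaddedPerSharper → …` / `_holds`.

At `m = 3` the tree's `KYCannotSeparatePaddedPerThreeFromFive` is stronger (`n ≥ 5`; `n = 4` by certificates); at `m = 4` the
threshold `n ≥ 7` is new (P4 gave `n ≥ 10`) and sits where an equation is known to exist in print
([LandsbergManivelRessayre2013] Thm. 1.0.1: `\underline{dc}(per_m) ≥ m²/2`, so `X₀₀^{n-4}per_4 ∉ \overline{GL_{n²}·det_n}` for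
`n ≤ 7`): at `(m,n) = (4,7)` the flattening family is provably silent where separation holds.  Other references as in
`Max/KYSharperAllM` ([LandsbergGCT2017] §8.2.1; [EfremenkoLandsbergSchenckWeyman2018] §1.1). [folklore]
-/

noncomputable section

namespace Summit.PneNP.GCT

open Literature.Computability.AlgebraicComplexity Literature.Barriers.ValiantsHypothesis

namespace KYCells

open Finset DetKYLeadingTerms KYAllM KYKOneExact

/-- **Generic assembly.** If `min(S(m,k)·C(n²,c+1), S(m,k+1)·C(n²,c)) ≤ LT(n,c,k)` at every primal cell (`2k+1 ≤ n`, `c+1 ≤ n²`),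
then `rank KY_{p,k}(X₀₀^{n-m}·per_m) ≤ rank KY_{p,k}(det_n)` at every `(p,k)` (`m ≤ n`). [folklore] -/
theorem kyRank_le_of_cells (m n : ℕ) [NeZero n] (hmn : m ≤ n)
    (hcell : ∀ c k : ℕ, 2 * k + 1 ≤ n → c + 1 ≤ n * n →
      min (chooseSqSum m k * (n * n).choose (c + 1)) (chooseSqSum m (k + 1) * (n * n).choose c) ≤ ltCount n c k)
    (p k : ℕ) : kyRank ℂ p k (paddedPerPoly ℂ m n) ≤ kyRank ℂ p k (detPoly (Fin n) ℂ) := by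
  obtain ⟨hlow, hhigh, hz⟩ := paddedPerKYUpperBounds_holds m n p k hmn
  rcases Nat.lt_or_ge k n with hk | hk
  swap
  · rw [hz hk]; exact Nat.zero_le _
  rcases Nat.lt_or_ge p (n * n) with hp | hp
  swap
  · have h0 : (∑ i ∈ range (k + 1 + 1), (m.choose i) ^ 2) * (n * n).choose (p + 1) = 0 := by
      rw [Nat.choose_eq_zero_of_lt (by omega : n * n < p + 1), Nat.mul_zero]
    have h := hlow.trans (min_le_right _ _)
    rw [h0] at h
    exact h.trans (Nat.zero_le _)
  have hpN : p + 1 ≤ n * n := hp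
  have hkn : k + 1 ≤ n := hk
  have hdetmax := detKYLeadingTermBound_holds n p k hpN hkn
  have hdet1 : ltCount n (n * n - 1 - p) k ≤ kyRank ℂ p k (detPoly (Fin n) ℂ) := (le_max_left _ _).trans hdetmax
  have hdet2 : ltCount n p (n - 1 - k) ≤ kyRank ℂ p k (detPoly (Fin n) ℂ) := (le_max_right _ _).trans hdetmax
  by_cases hks : 2 * k + 1 ≤ n
  · -- primal cell `(p,k)`, `c = n²-1-p`: `C(N,c+1) = C(N,p)`, `C(N,c) = C(N,p+1)`
    have hc : n * n - 1 - p + 1 ≤ n * n := by omega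
    have h1 : kyRank ℂ p k (paddedPerPoly ℂ m n) ≤
        min (chooseSqSum m k * (n * n).choose (n * n - 1 - p + 1)) (chooseSqSum m (k + 1) * (n * n).choose (n * n - 1 - p)) := by
      rw [show n * n - 1 - p + 1 = n * n - p by omega, Nat.choose_symm (Nat.le_of_succ_le hpN),
        show n * n - 1 - p = n * n - (p + 1) by omega, Nat.choose_symm hpN, KYSharper.chooseSqSum_eq, KYSharper.chooseSqSum_eq]
      exact hlow
    exact h1.trans ((hcell (n * n - 1 - p) k hks hc).trans hdet1)
  · -- dual cell: `k' = n-1-k` with `2k'+1 ≤ n`, `c = p`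
    have hks' : 2 * (n - 1 - k) + 1 ≤ n := by omega
    have h1 : kyRank ℂ p k (paddedPerPoly ℂ m n) ≤
        min (chooseSqSum m (n - 1 - k) * (n * n).choose (p + 1)) (chooseSqSum m (n - 1 - k + 1) * (n * n).choose p) := by
      rw [min_comm, show n - 1 - k + 1 = n - k by omega, KYSharper.chooseSqSum_eq, KYSharper.chooseSqSum_eq, show n - 1 - k = n - (k + 1) by omega]
      exact hhigh
    exact h1.trans ((hcell p (n - 1 - k) hks' hpN).trans hdet2)

/-- The primal cells for `n ≥ 2m+2`, from `KYAllM.stage2_cell` (the `n ≥ 2m+2` programme; only the low-order half of the `min`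
is used). [folklore] -/
theorem cells_of_stageTwo (m n : ℕ) (hn : 2 * m + 2 ≤ n) (c k : ℕ) (hk : 2 * k + 1 ≤ n) (hc : c + 1 ≤ n * n) :
    min (chooseSqSum m k * (n * n).choose (c + 1)) (chooseSqSum m (k + 1) * (n * n).choose c) ≤ ltCount n c k := by
  refine (min_le_left _ _).trans ?_
  have h := stage2_cell m n (n * n - 1 - c) k hn (by omega) (by omega)
  rwa [show n * n - 1 - c = n * n - (c + 1) by omega, Nat.choose_symm hc,
    show n * n - 1 - (n * n - (c + 1)) = c by omega] at h

/-! ## The nine finite cell tables (kernel-decided on the brute-force mirror `KYKOneExact.kCell`) -/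

/-- From a bounded `Bool` table to the cell inequalities at size `(m,n)`. [folklore] -/
theorem cells_of_table (m n K C : ℕ) (hK : (n - 1) / 2 ≤ K) (hC : n * n ≤ C + 1)
    (htab : ∀ k, k ≤ K → ∀ c, c ≤ C → kCell m n c k = true) (c k : ℕ) (hk : 2 * k + 1 ≤ n) (hc : c + 1 ≤ n * n) :
    min (chooseSqSum m k * (n * n).choose (c + 1)) (chooseSqSum m (k + 1) * (n * n).choose c) ≤ ltCount n c k :=
  kCell_sound m n c k (htab k (by omega) c (by omega))

/-- Cell table at `(m, n) = (0, 1)`. [folklore] -/ theorem table_0_1 : ∀ k, k ≤ 0 → ∀ c, c ≤ 0 → kCell 0 1 c k = true := by decide +kernel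
/-- Cell table at `(m, n) = (1, 3)`. [folklore] -/ theorem table_1_3 : ∀ k, k ≤ 1 → ∀ c, c ≤ 8 → kCell 1 3 c k = true := by decide +kernel
/-- Cell table at `(m, n) = (2, 4)`. [folklore] -/ theorem table_2_4 : ∀ k, k ≤ 1 → ∀ c, c ≤ 15 → kCell 2 4 c k = true := by decide +kernel
/-- Cell table at `(m, n) = (2, 5)`. [folklore] -/ theorem table_2_5 : ∀ k, k ≤ 2 → ∀ c, c ≤ 24 → kCell 2 5 c k = true := by decide +kernel
/-- Cell table at `(m, n) = (3, 6)`. [folklore] -/ theorem table_3_6 : ∀ k, k ≤ 2 → ∀ c, c ≤ 35 → kCell 3 6 c k = true := by decide +kernel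
/-- Cell table at `(m, n) = (3, 7)`. [folklore] -/ theorem table_3_7 : ∀ k, k ≤ 3 → ∀ c, c ≤ 48 → kCell 3 7 c k = true := by decide +kernel
/-- Cell table at `(m, n) = (4, 7)`. [folklore] -/ theorem table_4_7 : ∀ k, k ≤ 3 → ∀ c, c ≤ 48 → kCell 4 7 c k = true := by decide +kernel
/-- Cell table at `(m, n) = (4, 8)`. [folklore] -/ theorem table_4_8 : ∀ k, k ≤ 3 → ∀ c, c ≤ 63 → kCell 4 8 c k = true := by decide +kernel
/-- Cell table at `(m, n) = (4, 9)`. [folklore] -/ theorem table_4_9 : ∀ k, k ≤ 4 → ∀ c, c ≤ 80 → kCell 4 9 c k = true := by decide +kernel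

/-- The nine gap sizes: every primal cell inequality holds. [folklore] -/
theorem cells_gap (m n : ℕ)
    (h : m = 0 ∧ n = 1 ∨ m = 1 ∧ n = 3 ∨ m = 2 ∧ n = 4 ∨ m = 2 ∧ n = 5 ∨ m = 3 ∧ n = 6 ∨ m = 3 ∧ n = 7 ∨
      m = 4 ∧ n = 7 ∨ m = 4 ∧ n = 8 ∨ m = 4 ∧ n = 9)
    (c k : ℕ) (hk : 2 * k + 1 ≤ n) (hc : c + 1 ≤ n * n) :
    min (chooseSqSum m k * (n * n).choose (c + 1)) (chooseSqSum m (k + 1) * (n * n).choose c) ≤ ltCount n c k := by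
  rcases h with ⟨rfl, rfl⟩ | ⟨rfl, rfl⟩ | ⟨rfl, rfl⟩ | ⟨rfl, rfl⟩ | ⟨rfl, rfl⟩ | ⟨rfl, rfl⟩ | ⟨rfl, rfl⟩ | ⟨rfl, rfl⟩ | ⟨rfl, rfl⟩
  · exact cells_of_table 0 1 0 0 (by norm_num) (by norm_num) table_0_1 c k hk hc
  · exact cells_of_table 1 3 1 8 (by norm_num) (by norm_num) table_1_3 c k hk hc
  · exact cells_of_table 2 4 1 15 (by norm_num) (by norm_num) table_2_4 c k hk hc
  · exact cells_of_table 2 5 2 24 (by norm_num) (by norm_num) table_2_5 c k hk hc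
  · exact cells_of_table 3 6 2 35 (by norm_num) (by norm_num) table_3_6 c k hk hc
  · exact cells_of_table 3 7 3 48 (by norm_num) (by norm_num) table_3_7 c k hk hc
  · exact cells_of_table 4 7 3 48 (by norm_num) (by norm_num) table_4_7 c k hk hc
  · exact cells_of_table 4 8 3 63 (by norm_num) (by norm_num) table_4_8 c k hk hc
  · exact cells_of_table 4 9 4 80 (by norm_num) (by norm_num) table_4_9 c k hk hc

end KYCells

/-! ## The node -/

/-- **N-F-1 for EVERY `m` from `n = ⌈3m/2⌉+1` on (W1′a without the side condition `m ≥ 5`; PROVED —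
`kyCannotSeparatePaddedPerSharperEveryM_holds`):** for every `m`, every `n` with `2n ≥ 3m+2` and every `(p, k)`,
`rank KY_{p,k}(X₀₀^{n-m}·per_m) ≤ rank KY_{p,k}(det_n)` in `S^n(ℂ^{n²})`.  `m ≥ 5`: `KYCannotSeparatePaddedPerSharper`;
`m ≤ 4`, `n ≥ 2m+2`: the `n ≥ 2m+2` cells (`KYAllM.stage2_cell`); the nine remaining sizes by kernel-decided cell tables.
A ceiling for ONE family of equations; not a lower bound for `dc(per_m)`. [folklore] -/
def KYCannotSeparatePaddedPerSharperEveryM : Prop :=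
  ∀ (m n : ℕ) [NeZero n], 3 * m + 2 ≤ 2 * n → ∀ p k : ℕ,
    kyRank ℂ p k (paddedPerPoly ℂ m n) ≤ kyRank ℂ p k (detPoly (Fin n) ℂ)

/-- Reduction to W1′a (`m ≥ 5`): the `m ≤ 4` sizes are settled here. [folklore] -/
theorem kyCannotSeparatePaddedPerSharperEveryM_of (hS : KYCannotSeparatePaddedPerSharper) :
    KYCannotSeparatePaddedPerSharperEveryM := by
  intro m n _ hmn p k
  by_cases hm : 5 ≤ m
  · exact hS m n hm hmn p k
  by_cases h2 : 2 * m + 2 ≤ n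
  · exact KYCells.kyRank_le_of_cells m n (by omega) (KYCells.cells_of_stageTwo m n h2) p k
  · have h9 : m = 0 ∧ n = 1 ∨ m = 1 ∧ n = 3 ∨ m = 2 ∧ n = 4 ∨ m = 2 ∧ n = 5 ∨ m = 3 ∧ n = 6 ∨ m = 3 ∧ n = 7 ∨
        m = 4 ∧ n = 7 ∨ m = 4 ∧ n = 8 ∨ m = 4 ∧ n = 9 := by omega
    exact KYCells.kyRank_le_of_cells m n (by omega) (KYCells.cells_gap m n h9) p k

/-- `KYCannotSeparatePaddedPerSharperEveryM` holds. [folklore] -/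
theorem kyCannotSeparatePaddedPerSharperEveryM_holds : KYCannotSeparatePaddedPerSharperEveryM :=
  kyCannotSeparatePaddedPerSharperEveryM_of kyCannotSeparatePaddedPerSharper_holds

/-- It implies W1′a (`m ≥ 5`) and, at `m = 4`, the new threshold `n ≥ 7`. [folklore] -/
theorem kyRank_paddedPerPoly_four_le (n : ℕ) [NeZero n] (hn : 7 ≤ n) (p k : ℕ) :
    kyRank ℂ p k (paddedPerPoly ℂ 4 n) ≤ kyRank ℂ p k (detPoly (Fin n) ℂ) :=
  kyCannotSeparatePaddedPerSharperEveryM_holds 4 n (by omega) p k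

end Summit.PneNP.GCT
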